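import Literature.NumberTheory.Sieve.GoldstonPintzYildirimTwoVarPerron
import HarnessLib

/-!
# The double Perron identity behind GPY (7.7)/(9.15), for a general coefficient family

Trunk: NumberTheory / Sieve. GPY, *Primes in tuples. I* (Ann. of Math. 170 (2009) =
arXiv:math/0508185) write the main terms `T_R` ((7.6)) and `𝒯̃_R` ((9.12)) — finite double sums
`∑_{d,e ≤ R} c(d,e) (log R/d)^A/A! · (log R/e)^B/B!` — as double line integrals
`(2πi)⁻² ∫_(1)∫_(1) F(s₁,s₂) R^{s₁}s₁^{−(A+1)} R^{s₂}s₂^{−(B+1)} ds₁ds₂` of the double Dirichlet series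
`F(s₁,s₂) = ∑_{d,e} c(d,e) d^{−s₁}e^{−s₂}` ((6.6) in each variable; (7.7), (9.15)).
`GoldstonPintzYildirimTwoVarPerron` proves this for the coefficients `c(d,e) = μ(d)μ(e)nuJoint/[d,e]`
of (7.7); this file abstracts its argument to an ARBITRARY real family `c(d,e)` with
`c(0,e) = c(d,0) = 0` and `∑ |c(d,e)|/(de) < ∞`, so that the `φ`-weighted series of §9 is covered by
instantiation (`GoldstonPintzYildirimThetaPerron`). Everything here is PROVED (theorems only):

* `div_cpow_mul_perronPow` — the termwise identity
  `c d^{−s₁}e^{−s₂} · R^{s₁}s₁^{−(A+1)} · R^{s₂}s₂^{−(B+1)} = c (R/d)^{s₁}s₁^{−(A+1)} (R/e)^{s₂}s₂^{−(B+1)}`;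
* `integral_integral_tsum_mul_perronPow` — for `A, B ≥ 1`, `R > 0`:
  `∫∫ (∑_{d,e} c(d,e) d^{−s₁}e^{−s₂}) R^{s₁}s₁^{−(A+1)} R^{s₂}s₂^{−(B+1)} dt₁dt₂`
  `= (2π)² ∑_{1 ≤ d,e ≤ R} c(d,e) (log R/d)^A/A! (log R/e)^B/B!` (`sⱼ = 1 + itⱼ`; Fubini–Tonelli
  with the `L¹` bound `|c(d,e)| (R/d)π (R/e)π` and `Literature.Analysis.Complex.integral_perronPow_vertical`).

## References

* D. A. Goldston, J. Pintz, C. Y. Yıldırım, *Primes in tuples. I*, Ann. of Math. (2) 170 (2009),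
  819–862 = arXiv:math/0508185, §6 (6.6), §7 (7.7), §9 (9.15). [cite: GoldstonPintzYildirim2009]
-/

noncomputable section

open Finset MeasureTheory Complex Literature.Analysis.Complex

namespace Literature.NumberTheory.Sieve.GPY

/-- The termwise identity behind (7.7)/(9.15): on multiplying by the two Perron kernels,
`c d^{−s₁}e^{−s₂} · R^{s₁}s₁^{−(A+1)} · R^{s₂}s₂^{−(B+1)} = c · (R/d)^{s₁}s₁^{−(A+1)} · (R/e)^{s₂}s₂^{−(B+1)}`
(`R ≥ 0`, `d, e ≥ 1`, `sᵢ ≠ 0`). [cite: GoldstonPintzYildirim2009, Section 9 eq. 9.15] -/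
theorem div_cpow_mul_perronPow {R : ℝ} (hR : 0 ≤ R) (c : ℂ) (A B : ℕ) {s₁ s₂ : ℂ} (hs₁ : s₁ ≠ 0)
    (hs₂ : s₂ ≠ 0) {d e : ℕ} (hd : 0 < d) (he : 0 < e) :
    c / ((d : ℂ) ^ s₁ * (e : ℂ) ^ s₂) * perronPow R A s₁ * perronPow R B s₂ =
      c * perronPow (R / d) A s₁ * perronPow (R / e) B s₂ := by
  have hd0 : (d : ℂ) ≠ 0 := by exact_mod_cast hd.ne'
  have he0 : (e : ℂ) ≠ 0 := by exact_mod_cast he.ne'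
  have hds : (d : ℂ) ^ s₁ ≠ 0 := Complex.cpow_ne_zero_iff.2 (Or.inl hd0)
  have hes : (e : ℂ) ^ s₂ ≠ 0 := Complex.cpow_ne_zero_iff.2 (Or.inl he0)
  have hs₁' : s₁ ^ (A + 1) ≠ 0 := pow_ne_zero _ hs₁
  have hs₂' : s₂ ^ (B + 1) ≠ 0 := pow_ne_zero _ hs₂
  unfold perronPow
  rw [ofReal_div_natCast_cpow hR hd, ofReal_div_natCast_cpow hR he]
  field_simp

/-- **The double Perron identity** (GPY (6.6) twice, with the interchanges justified): for a real
family `c(d,e)` vanishing when `d = 0` or `e = 0` with `∑ |c(d,e)|/(de) < ∞`, `R > 0`, `A, B ≥ 1`,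
`sⱼ = 1 + itⱼ`:
`∫∫ (∑_{d,e} c(d,e) d^{−s₁}e^{−s₂}) R^{s₁}s₁^{−(A+1)} R^{s₂}s₂^{−(B+1)} dt₁dt₂ = (2π)² ∑_{1 ≤ d,e ≤ R} c(d,e)(log R/d)^A/A! (log R/e)^B/B!`
(the proof of `integral_integral_FDir₂_mul_perronPow` with the coefficient abstracted).
[cite: GoldstonPintzYildirim2009, Section 9 eq. 9.15] -/
theorem integral_integral_tsum_mul_perronPow {c : ℕ → ℕ → ℝ} (hc0l : ∀ e, c 0 e = 0)
    (hc0r : ∀ d, c d 0 = 0) (hsumc : Summable fun p : ℕ × ℕ => |c p.1 p.2| / ((p.1 : ℝ) * p.2))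
    {R : ℝ} (hR : 0 < R) {A B : ℕ} (hA : 1 ≤ A) (hB : 1 ≤ B) :
    ∫ t₂ : ℝ, ∫ t₁ : ℝ, (∑' p : ℕ × ℕ, (c p.1 p.2 : ℂ) /
        ((p.1 : ℂ) ^ (((1 : ℝ) : ℂ) + t₁ * I) * (p.2 : ℂ) ^ (((1 : ℝ) : ℂ) + t₂ * I))) *
        perronPow R A (((1 : ℝ) : ℂ) + t₁ * I) * perronPow R B (((1 : ℝ) : ℂ) + t₂ * I) =
      (2 * Real.pi) ^ 2 * ∑ p ∈ Icc 1 ⌊R⌋₊ ×ˢ Icc 1 ⌊R⌋₊, (c p.1 p.2 : ℂ) *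
        ((((Real.log (R / p.1) : ℝ) : ℂ) ^ A / (A.factorial : ℂ)) *
          (((Real.log (R / p.2) : ℝ) : ℂ) ^ B / (B.factorial : ℂ))) := by
  set cc : ℕ × ℕ → ℂ := fun p => (c p.1 p.2 : ℂ) with hcdef
  set pp : ℕ → ℕ → ℝ → ℂ := fun m d t => perronPow (R / d) m (((1 : ℝ) : ℂ) + t * I) with hppdef
  set V : ℕ → ℕ → ℂ := fun m d => ∫ t : ℝ, pp m d t with hVdef
  have hs0 : ∀ t : ℝ, (((1 : ℝ) : ℂ) + t * I) ≠ 0 := fun t h => by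
    have := congrArg Complex.re h; simp at this
  have hs0' : ∀ t : ℝ, (1 : ℂ) + t * I ≠ 0 := fun t h => by
    have := congrArg Complex.re h; simp at this
  have hnc : ∀ p : ℕ × ℕ, ‖cc p‖ = |c p.1 p.2| := fun p => by
    simp [hcdef, Complex.norm_real]
  have hcc0 : ∀ p : ℕ × ℕ, p.1 = 0 ∨ p.2 = 0 → cc p = 0 := by
    rintro ⟨d, e⟩ (h | h)
    · simp only at h; subst h; simp [hcdef, hc0l]
    · simp only at h; subst h; simp [hcdef, hc0r]
  have hpp_le : ∀ (m d : ℕ) (t : ℝ), ‖pp m d t‖ ≤ R / d := fun m d t =>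
    norm_perronPow_div_le hR m d t
  have hpp_int : ∀ {m : ℕ}, 1 ≤ m → ∀ d : ℕ, Integrable (pp m d) := by
    intro m hm d
    rcases Nat.eq_zero_or_pos d with rfl | hd
    · have : pp m 0 = fun _ => 0 := by
        funext t; simp [hppdef, perronPow, Complex.zero_cpow (hs0' t)]
      rw [this]; exact integrable_zero _ _ _
    · exact integrable_perronPow_vertical (div_pos hR (by exact_mod_cast hd)) hm one_ne_zero
  have hpp_L1 : ∀ {m : ℕ}, 1 ≤ m → ∀ d : ℕ, ∫ t : ℝ, ‖pp m d t‖ ≤ R / d * Real.pi := by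
    intro m hm d
    rcases Nat.eq_zero_or_pos d with rfl | hd
    · simp [hppdef, perronPow, Complex.zero_cpow (hs0' _)]
    · exact integral_norm_perronPow_one_le (div_pos hR (by exact_mod_cast hd)) hm
  have hV_le : ∀ {m : ℕ}, 1 ≤ m → ∀ d : ℕ, ‖V m d‖ ≤ R / d * Real.pi := fun hm d =>
    (norm_integral_le_integral_norm _).trans (hpp_L1 hm d)
  -- (a) pointwise expansion of the integrand
  have hterm : ∀ (t₁ t₂ : ℝ) (p : ℕ × ℕ),
      (c p.1 p.2 : ℂ) / ((p.1 : ℂ) ^ (((1 : ℝ) : ℂ) + t₁ * I) * (p.2 : ℂ) ^ (((1 : ℝ) : ℂ) + t₂ * I)) *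
        perronPow R A (((1 : ℝ) : ℂ) + t₁ * I) * perronPow R B (((1 : ℝ) : ℂ) + t₂ * I) =
      cc p * pp A p.1 t₁ * pp B p.2 t₂ := by
    intro t₁ t₂ p
    obtain ⟨d, e⟩ := p
    rcases Nat.eq_zero_or_pos d with rfl | hd
    · simp [hcdef, hc0l]
    rcases Nat.eq_zero_or_pos e with rfl | he
    · simp [hcdef, hc0r]
    exact div_cpow_mul_perronPow hR.le _ A B (hs0 t₁) (hs0 t₂) hd he
  have hpt : ∀ t₁ t₂ : ℝ,
      (∑' p : ℕ × ℕ, (c p.1 p.2 : ℂ) /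
        ((p.1 : ℂ) ^ (((1 : ℝ) : ℂ) + t₁ * I) * (p.2 : ℂ) ^ (((1 : ℝ) : ℂ) + t₂ * I))) *
        perronPow R A (((1 : ℝ) : ℂ) + t₁ * I) * perronPow R B (((1 : ℝ) : ℂ) + t₂ * I) =
      ∑' p : ℕ × ℕ, cc p * pp A p.1 t₁ * pp B p.2 t₂ := by
    intro t₁ t₂
    rw [← tsum_mul_right, ← tsum_mul_right]
    exact tsum_congr fun p => hterm t₁ t₂ p
  -- (b) the inner integral
  have hinner : ∀ t₂ : ℝ, ∫ t₁ : ℝ, ∑' p : ℕ × ℕ, cc p * pp A p.1 t₁ * pp B p.2 t₂ =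
      ∑' p : ℕ × ℕ, cc p * V A p.1 * pp B p.2 t₂ := by
    intro t₂
    have hint : ∀ p : ℕ × ℕ, Integrable fun t₁ : ℝ => cc p * pp A p.1 t₁ * pp B p.2 t₂ := by
      intro p
      exact ((hpp_int hA p.1).const_mul (cc p)).mul_const (pp B p.2 t₂)
    have hsum : Summable fun p : ℕ × ℕ => ∫ t₁ : ℝ, ‖cc p * pp A p.1 t₁ * pp B p.2 t₂‖ := by
      refine Summable.of_nonneg_of_le (fun p => integral_nonneg fun t => norm_nonneg _)
        (fun p => ?_) (hsumc.mul_left (R * R * Real.pi))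
      have e1 : ∫ t₁ : ℝ, ‖cc p * pp A p.1 t₁ * pp B p.2 t₂‖ =
          ‖cc p‖ * ‖pp B p.2 t₂‖ * ∫ t₁ : ℝ, ‖pp A p.1 t₁‖ := by
        have : (fun t₁ : ℝ => ‖cc p * pp A p.1 t₁ * pp B p.2 t₂‖) =
            fun t₁ => ‖cc p‖ * ‖pp B p.2 t₂‖ * ‖pp A p.1 t₁‖ := by
          funext t₁; simp only [norm_mul]; ring
        rw [this, MeasureTheory.integral_const_mul]
      rw [e1, hnc]
      rcases Nat.eq_zero_or_pos p.1 with h0 | hd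
      · simp [h0, hc0l]
      rcases Nat.eq_zero_or_pos p.2 with h0 | he
      · simp [h0, hc0r]
      have hd0 : (0 : ℝ) < p.1 := by exact_mod_cast hd
      have he0 : (0 : ℝ) < p.2 := by exact_mod_cast he
      calc |c p.1 p.2| * ‖pp B p.2 t₂‖ * ∫ t₁ : ℝ, ‖pp A p.1 t₁‖
          ≤ |c p.1 p.2| * (R / p.2) * (R / p.1 * Real.pi) := by
            gcongr
            · exact hpp_le B p.2 t₂
            · exact hpp_L1 hA p.1
        _ = R * R * Real.pi * (|c p.1 p.2| / ((p.1 : ℝ) * p.2)) := by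
            field_simp
    rw [← integral_tsum_of_summable_integral_norm hint hsum]
    refine tsum_congr fun p => ?_
    have : (fun t₁ : ℝ => cc p * pp A p.1 t₁ * pp B p.2 t₂) =
        fun t₁ => cc p * pp B p.2 t₂ * pp A p.1 t₁ := by funext t₁; ring
    rw [this, MeasureTheory.integral_const_mul]
    simp only [hVdef]; ring
  -- (c) the outer integral
  have houter : ∫ t₂ : ℝ, ∑' p : ℕ × ℕ, cc p * V A p.1 * pp B p.2 t₂ =
      ∑' p : ℕ × ℕ, cc p * V A p.1 * V B p.2 := by
    have hint : ∀ p : ℕ × ℕ, Integrable fun t₂ : ℝ => cc p * V A p.1 * pp B p.2 t₂ := fun p =>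
      (hpp_int hB p.2).const_mul _
    have hsum : Summable fun p : ℕ × ℕ => ∫ t₂ : ℝ, ‖cc p * V A p.1 * pp B p.2 t₂‖ := by
      refine Summable.of_nonneg_of_le (fun p => integral_nonneg fun t => norm_nonneg _)
        (fun p => ?_) (hsumc.mul_left (R * R * Real.pi * Real.pi))
      have e1 : ∫ t₂ : ℝ, ‖cc p * V A p.1 * pp B p.2 t₂‖ =
          ‖cc p‖ * ‖V A p.1‖ * ∫ t₂ : ℝ, ‖pp B p.2 t₂‖ := by
        have : (fun t₂ : ℝ => ‖cc p * V A p.1 * pp B p.2 t₂‖) =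
            fun t₂ => ‖cc p‖ * ‖V A p.1‖ * ‖pp B p.2 t₂‖ := by
          funext t₂; simp only [norm_mul]
        rw [this, MeasureTheory.integral_const_mul]
      rw [e1, hnc]
      rcases Nat.eq_zero_or_pos p.1 with h0 | hd
      · simp [h0, hc0l]
      rcases Nat.eq_zero_or_pos p.2 with h0 | he
      · simp [h0, hc0r]
      have hd0 : (0 : ℝ) < p.1 := by exact_mod_cast hd
      have he0 : (0 : ℝ) < p.2 := by exact_mod_cast he
      calc |c p.1 p.2| * ‖V A p.1‖ * ∫ t₂ : ℝ, ‖pp B p.2 t₂‖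
          ≤ |c p.1 p.2| * (R / p.1 * Real.pi) * (R / p.2 * Real.pi) := by
            gcongr
            · exact hV_le hA p.1
            · exact hpp_L1 hB p.2
        _ = R * R * Real.pi * Real.pi * (|c p.1 p.2| / ((p.1 : ℝ) * p.2)) := by
            field_simp
    rw [← integral_tsum_of_summable_integral_norm hint hsum]
    refine tsum_congr fun p => ?_
    rw [MeasureTheory.integral_const_mul]
  -- (d) evaluate the terms and reduce to the finite sum
  have hV : ∀ {m : ℕ}, 1 ≤ m → ∀ d : ℕ, 1 ≤ d → V m d =
      if 1 ≤ R / d then 2 * Real.pi * (((Real.log (R / d) : ℝ) : ℂ) ^ m / (m.factorial : ℂ))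
      else 0 := by
    intro m hm d hd
    simp only [hVdef, hppdef]
    exact integral_perronPow_vertical (div_pos hR (by exact_mod_cast hd)) one_pos hm
  have hRd : ∀ d : ℕ, d ∈ Icc 1 ⌊R⌋₊ → 1 ≤ R / d := by
    intro d hd
    obtain ⟨hd1, hdR⟩ := Finset.mem_Icc.1 hd
    have hd0 : (0 : ℝ) < d := by exact_mod_cast hd1
    rw [le_div_iff₀ hd0, one_mul]
    exact le_trans (by exact_mod_cast hdR) (Nat.floor_le hR.le)
  have hV0 : ∀ {m : ℕ}, 1 ≤ m → ∀ d : ℕ, d ∉ Icc 1 ⌊R⌋₊ → d ≠ 0 → V m d = 0 := by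
    intro m hm d hd hd0
    rw [Finset.mem_Icc, not_and_or, not_le, not_le] at hd
    rcases hd with hd | hd
    · omega
    · have hd1 : 1 ≤ d := by omega
      rw [hV hm d hd1]
      have hlt : R / d < 1 := by
        rw [div_lt_one (by exact_mod_cast (show 0 < d by omega))]
        exact_mod_cast (Nat.floor_lt hR.le).1 hd
      rw [if_neg (not_le.2 hlt)]
  have hsupp : ∀ p : ℕ × ℕ, p ∉ Icc 1 ⌊R⌋₊ ×ˢ Icc 1 ⌊R⌋₊ → cc p * V A p.1 * V B p.2 = 0 := by
    intro p hp
    rw [Finset.mem_product, not_and_or] at hp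
    rcases Nat.eq_zero_or_pos p.1 with h0 | hd
    · rw [hcc0 p (Or.inl h0)]; ring
    rcases Nat.eq_zero_or_pos p.2 with h0 | he
    · rw [hcc0 p (Or.inr h0)]; ring
    rcases hp with hp | hp
    · rw [hV0 hA p.1 hp hd.ne']; ring
    · rw [hV0 hB p.2 hp he.ne']; ring
  -- assemble
  have hfun : (fun t₂ : ℝ => ∫ t₁ : ℝ, (∑' p : ℕ × ℕ, (c p.1 p.2 : ℂ) /
        ((p.1 : ℂ) ^ (((1 : ℝ) : ℂ) + t₁ * I) * (p.2 : ℂ) ^ (((1 : ℝ) : ℂ) + t₂ * I))) *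
        perronPow R A (((1 : ℝ) : ℂ) + t₁ * I) * perronPow R B (((1 : ℝ) : ℂ) + t₂ * I)) =
      fun t₂ => ∑' p : ℕ × ℕ, cc p * V A p.1 * pp B p.2 t₂ := by
    funext t₂
    rw [show (fun t₁ : ℝ => (∑' p : ℕ × ℕ, (c p.1 p.2 : ℂ) /
        ((p.1 : ℂ) ^ (((1 : ℝ) : ℂ) + t₁ * I) * (p.2 : ℂ) ^ (((1 : ℝ) : ℂ) + t₂ * I))) *
        perronPow R A (((1 : ℝ) : ℂ) + t₁ * I) * perronPow R B (((1 : ℝ) : ℂ) + t₂ * I)) =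
      fun t₁ => ∑' p : ℕ × ℕ, cc p * pp A p.1 t₁ * pp B p.2 t₂ from funext fun t₁ => hpt t₁ t₂]
    exact hinner t₂
  rw [hfun, houter, tsum_eq_sum (s := Icc 1 ⌊R⌋₊ ×ˢ Icc 1 ⌊R⌋₊) (fun p hp => hsupp p hp),
    Finset.mul_sum]
  refine Finset.sum_congr rfl fun p hp => ?_
  obtain ⟨hd, he⟩ := Finset.mem_product.1 hp
  have hd1 : 1 ≤ p.1 := (Finset.mem_Icc.1 hd).1
  have he1 : 1 ≤ p.2 := (Finset.mem_Icc.1 he).1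
  rw [hV hA p.1 hd1, hV hB p.2 he1, if_pos (hRd p.1 hd), if_pos (hRd p.2 he)]
  simp only [hcdef]
  ring

end Literature.NumberTheory.Sieve.GPY
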